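/-
Copyright (c) 2026. All rights reserved.
Released under Apache 2.0 license as described in the file LICENSE.
-/
import Literature.NumberTheory.Waring.ThreeSquaresCount
import HarnessLib

/-!
# Gauss's count of the PRIMITIVE representations as a sum of three squares: `R₃(n) = 12·h_w(−4n)`, `24·h_w(−n)`

`R₃(n) = #{(x, y, z) ∈ ℤ³ : x² + y² + z² = n, gcd(x, y, z) = 1}` (Grosswald's notation; Mortenson's `N₃(n)`). GAUSS'S
THEOREM in its original, primitive form (Disq. Arith. Art. 291; Grosswald's Theorem 2 with `δ₁ = ½`, `δ₃ = ⅓` absorbed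
into the weighted class number `h_w = h/(w/2)` of the tree):

  `R₃(n) = 12·h_w(−4n)` for `n ≡ 1, 2 (mod 4)`,  `R₃(n) = 24·h_w(−n)` for `n ≡ 3 (mod 8)`,
  `R₃(n) = 0` for `n ≡ 0 (mod 4)` and for `n ≡ 7 (mod 8)`,

deduced from the total count `r₃(n) = 12H(4n)`, `24H(n)` of `Waring/ThreeSquaresCount` through Grosswald's (4.8)
`r₃(n) = Σ_{d² ∣ n} R₃(n/d²)` and the conductor sums `H(4n) = Σ_{d² ∣ n} h_w(−4n/d²)`, `H(n) = Σ_{d² ∣ n} h_w(−n/d²)` in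
these residue classes, by strong induction on `n`.

* §1 (private gcd plumbing) and **`card_eq_sum_card_primitive`** (`r₃(n) = Σ_{d² ∣ n} R₃(n/d²)`, `n > 0`: the explicit
  equivalence `y ↦ (gcd y, y/gcd y)` onto `Σ_{d} {primitive solutions for n/d²}`).
* §2 `card_primitive_eq_zero_of_four_dvd` (`4 ∣ n ⟹ R₃(n) = 0`: all coordinates even), 
  `card_primitive_eq_zero_of_mod_eight_eq_seven`.
* §3 `hurwitzClassNumber_eq_sum_sq_dvd` (`n ≡ 3 (mod 8)`: `H(n) = Σ_{d² ∣ n} h_w(−n/d²)`),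
  `hurwitzClassNumber_four_mul_eq_sum_sq_dvd` (`n ≡ 1, 2 (mod 4)`: `H(4n) = Σ_{d² ∣ n} h_w(−4n/d²)` — no even conductor).
* §4 **`card_primitive_of_mod_eight_eq_three`** (`R₃(n) = 24·h_w(−n)`), **`card_primitive_of_mod_four`**
  (`R₃(n) = 12·h_w(−4n)`), the plain-class-number forms `…_eq_classNumber_…` (`n > 3` resp. `n > 1`: Grosswald's
  `24h`, `12h`), and the values `R₃(1) = 6`, `R₃(3) = 8`.
* §5 **`card_primitive_pos_iff`** (`R₃(n) > 0 ⟺ 4 ∤ n ∧ n ≢ 7 (mod 8)`, i.e. `n ≢ 0, 4, 7 (mod 8)`).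

## Sources

* C. F. Gauss, *Disquisitiones Arithmeticae* (1801), Art. 291 («the number of proper representations of a given
  positive number M by the form x² + y² + z²» through the classes of forms of determinant −M). [cite: Gauss1801, Art. 291]
* E. Grosswald, *Representations of Integers as Sums of Squares* (1985), Ch. 4 §8 Thm. 2 («R₃(n) = 12hδ_n if
  n ≡ 1, 2, 5, or 6 (mod 8), 24hδ_n if n ≡ 3 (mod 8)», `δ₁ = ½`, `δ₃ = ⅓`, `h` the number of classes of primitive
  forms of discriminant `−4n` resp. `−n`), (4.8) («r₃(n) = Σ_{d² ∣ n} R₃(n/d²)») and the examples `R₃(1) = 6`,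
  `R₃(5) = 24`. [cite: Grosswald1985, Ch. 4 §8 Thm. 2, (4.7)–(4.8)]
* E. T. Mortenson, Bull. LMS 49 (2017), Thm. 3 (Gauss: `N₃(n) = 12δ_n h(−4n)`, `24δ_n h(−n)`). [cite: Mortenson2017, Thm. 3]

## Scope (honest)

Theorems only — no definition, no named fact, no instance; `R₃(n)` is spelled as the `Nat.card` of a subtype of `ℤ³`
with `Int.gcd (Int.gcd x y) z = 1`, and the class numbers are the tree's `weightedClassNumber` /
`BinaryQuadraticForm.classNumber`. The residue classes `n ≡ 0 (mod 4)` and `n ≡ 7 (mod 8)` have `R₃ = 0`.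
-/

open Finset
open Literature.NumberTheory.QuadraticFields
open Literature.NumberTheory.Automorphic.HeckeTraceFormulaGL2Level (weightedClassNumber)
open BinaryQuadraticForm (classNumber)

namespace Literature.NumberTheory.Waring.ThreeSquaresPrimitiveCount

/-! ## §1 `r₃(n) = Σ_{d² ∣ n} R₃(n/d²)` -/

section Decomposition

/-- The gcd of three integers divides each of them. [folklore] -/
private theorem gcd_dvd (a b c : ℤ) :
    ((Int.gcd (Int.gcd a b) c : ℕ) : ℤ) ∣ a ∧ ((Int.gcd (Int.gcd a b) c : ℕ) : ℤ) ∣ b ∧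
      ((Int.gcd (Int.gcd a b) c : ℕ) : ℤ) ∣ c :=
  ⟨(Int.gcd_dvd_left _ c).trans (Int.gcd_dvd_left a b), (Int.gcd_dvd_left _ c).trans (Int.gcd_dvd_right a b),
    Int.gcd_dvd_right _ c⟩

/-- `gcd(da, db, dc) = d·gcd(a, b, c)` for `d ∈ ℕ`. [folklore] -/
private theorem gcd_mul (d : ℕ) (a b c : ℤ) :
    Int.gcd (Int.gcd ((d : ℤ) * a) ((d : ℤ) * b)) ((d : ℤ) * c) = d * Int.gcd (Int.gcd a b) c := by
  rw [Int.gcd_mul_left, Int.natAbs_natCast, Nat.cast_mul, Int.gcd_mul_left, Int.natAbs_natCast]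

/-- Dividing by the gcd leaves gcd `1`. [folklore] -/
private theorem gcd_ediv (a b c : ℤ) (hg : 0 < Int.gcd (Int.gcd a b) c) :
    Int.gcd (Int.gcd (a / (Int.gcd (Int.gcd a b) c : ℕ)) (b / (Int.gcd (Int.gcd a b) c : ℕ)))
      (c / (Int.gcd (Int.gcd a b) c : ℕ)) = 1 := by
  obtain ⟨ha, hb, hc⟩ := gcd_dvd a b c
  have hG : ((Int.gcd (Int.gcd a b) c : ℕ) : ℤ) ∣ (Int.gcd a b : ℕ) := Int.gcd_dvd_left _ c
  rw [Int.gcd_ediv ha hb, Int.natAbs_natCast, Int.natCast_div, Int.gcd_ediv hG hc, Int.natAbs_natCast,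
    Nat.div_self hg]

/-- The primitive solutions for `m` form a finite set (`|yᵢ| ≤ yᵢ² ≤ m`). [folklore] -/
private theorem finite_prim (m : ℕ) : Finite {y : ℤ × ℤ × ℤ // y.1 ^ 2 + y.2.1 ^ 2 + y.2.2 ^ 2 = (m : ℤ) ∧ Int.gcd (Int.gcd y.1 y.2.1) y.2.2 = 1} := by
  have hsub : {y : ℤ × ℤ × ℤ | y.1 ^ 2 + y.2.1 ^ 2 + y.2.2 ^ 2 = (m : ℤ) ∧ Int.gcd (Int.gcd y.1 y.2.1) y.2.2 = 1} ⊆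
      ↑((Finset.Icc (-(m : ℤ)) m) ×ˢ ((Finset.Icc (-(m : ℤ)) m) ×ˢ (Finset.Icc (-(m : ℤ)) m))) := by
    rintro ⟨a, b, c⟩ ⟨h, -⟩
    simp only at h
    have ha : |a| ≤ m := by
      rw [Int.abs_eq_natAbs]; exact (Int.natAbs_le_self_sq a).trans (by nlinarith [sq_nonneg b, sq_nonneg c])
    have hb : |b| ≤ m := by
      rw [Int.abs_eq_natAbs]; exact (Int.natAbs_le_self_sq b).trans (by nlinarith [sq_nonneg a, sq_nonneg c])
    have hc : |c| ≤ m := by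
      rw [Int.abs_eq_natAbs]; exact (Int.natAbs_le_self_sq c).trans (by nlinarith [sq_nonneg a, sq_nonneg b])
    simp only [Finset.coe_product, Finset.coe_Icc, Set.mem_prod, Set.mem_Icc]
    exact ⟨abs_le.1 ha, abs_le.1 hb, abs_le.1 hc⟩
  exact ((Finset.finite_toSet _).subset hsub).to_subtype

/-- For a solution `y` of `Σ yᵢ² = n > 0` with `g = gcd(y)`: `g ≥ 1`, `g² ∣ n`, and `y/g` is a primitive solution for
`n/g²`. [cite: Grosswald1985, Ch. 4 §8 (4.8)] -/
private theorem div_gcd_spec {n : ℕ} (hn : 0 < n) {a b c : ℤ} (h : a ^ 2 + b ^ 2 + c ^ 2 = (n : ℤ)) :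
    Int.gcd (Int.gcd a b) c ∈ ((Finset.Icc 1 n).filter (fun d : ℕ => d ^ 2 ∣ n)) ∧
      ((a / (Int.gcd (Int.gcd a b) c : ℕ)) ^ 2 + (b / (Int.gcd (Int.gcd a b) c : ℕ)) ^ 2 +
            (c / (Int.gcd (Int.gcd a b) c : ℕ)) ^ 2 = ((n / Int.gcd (Int.gcd a b) c ^ 2 : ℕ) : ℤ) ∧
        Int.gcd (Int.gcd (a / (Int.gcd (Int.gcd a b) c : ℕ)) (b / (Int.gcd (Int.gcd a b) c : ℕ)))
          (c / (Int.gcd (Int.gcd a b) c : ℕ)) = 1) := by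
  set g : ℕ := Int.gcd (Int.gcd a b) c with hg
  obtain ⟨⟨a', ha⟩, ⟨b', hb⟩, ⟨c', hc⟩⟩ := gcd_dvd a b c
  rw [← hg] at ha hb hc
  have hg0 : 0 < g := by
    rcases Nat.eq_zero_or_pos g with h0 | h0
    · exfalso
      rw [h0, Nat.cast_zero, zero_mul] at ha hb hc
      rw [ha, hb, hc] at h
      norm_num at h
      omega
    · exact h0
  have hg0' : (g : ℤ) ≠ 0 := by exact_mod_cast hg0.ne'
  have hsum : (g : ℤ) ^ 2 * (a' ^ 2 + b' ^ 2 + c' ^ 2) = n := by rw [← h, ha, hb, hc]; ring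
  have hdvd : g ^ 2 ∣ n := by
    have : ((g ^ 2 : ℕ) : ℤ) ∣ (n : ℤ) := ⟨a' ^ 2 + b' ^ 2 + c' ^ 2, by rw [← hsum]; push_cast; ring⟩
    exact_mod_cast this
  have hquot : ((n / g ^ 2 : ℕ) : ℤ) = a' ^ 2 + b' ^ 2 + c' ^ 2 := by
    obtain ⟨e, he⟩ := hdvd
    rw [he, Nat.mul_div_cancel_left _ (pow_pos hg0 2)]
    have : ((g : ℤ)) ^ 2 * (a' ^ 2 + b' ^ 2 + c' ^ 2) = ((g : ℤ)) ^ 2 * (e : ℤ) := by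
      rw [hsum, he]; push_cast; ring
    exact (mul_left_cancel₀ (pow_ne_zero 2 hg0') this).symm
  refine ⟨?_, ?_, gcd_ediv a b c hg0⟩
  · rw [Finset.mem_filter, Finset.mem_Icc]
    refine ⟨⟨hg0, ?_⟩, hdvd⟩
    exact (Nat.le_self_pow two_ne_zero g).trans (Nat.le_of_dvd hn hdvd)
  · rw [ha, hb, hc, Int.mul_ediv_cancel_left _ hg0', Int.mul_ediv_cancel_left _ hg0',
      Int.mul_ediv_cancel_left _ hg0', hquot]

/-- **GROSSWALD (4.8): `r₃(n) = Σ_{d² ∣ n} R₃(n/d²)`** (`n > 0`): the solutions of `Σ yᵢ² = n` are the `d·y'` with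
`d = gcd ≥ 1`, `d² ∣ n` and `y'` a primitive solution for `n/d²` — an explicit equivalence onto the sigma type,
counted with `Nat.card_sigma`. [cite: Grosswald1985, Ch. 4 §8 (4.8)] -/
theorem card_eq_sum_card_primitive {n : ℕ} (hn : 0 < n) :
    Nat.card {y : ℤ × ℤ × ℤ // y.1 ^ 2 + y.2.1 ^ 2 + y.2.2 ^ 2 = (n : ℤ)} = ∑ d ∈ ((Finset.Icc 1 n).filter (fun d : ℕ => d ^ 2 ∣ n)), Nat.card {y : ℤ × ℤ × ℤ // y.1 ^ 2 + y.2.1 ^ 2 + y.2.2 ^ 2 = ((n / d ^ 2 : ℕ) : ℤ) ∧ Int.gcd (Int.gcd y.1 y.2.1) y.2.2 = 1} := by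
  haveI : ∀ d : ((Finset.Icc 1 n).filter (fun d : ℕ => d ^ 2 ∣ n)), Finite {y : ℤ × ℤ × ℤ // y.1 ^ 2 + y.2.1 ^ 2 + y.2.2 ^ 2 = ((n / d.1 ^ 2 : ℕ) : ℤ) ∧ Int.gcd (Int.gcd y.1 y.2.1) y.2.2 = 1} := fun d => finite_prim _
  let e : {y : ℤ × ℤ × ℤ // y.1 ^ 2 + y.2.1 ^ 2 + y.2.2 ^ 2 = (n : ℤ)} ≃ Σ d : ((Finset.Icc 1 n).filter (fun d : ℕ => d ^ 2 ∣ n)), {y : ℤ × ℤ × ℤ // y.1 ^ 2 + y.2.1 ^ 2 + y.2.2 ^ 2 = ((n / d.1 ^ 2 : ℕ) : ℤ) ∧ Int.gcd (Int.gcd y.1 y.2.1) y.2.2 = 1} :=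
    { toFun := fun y =>
        ⟨⟨Int.gcd (Int.gcd y.1.1 y.1.2.1) y.1.2.2, (div_gcd_spec hn y.2).1⟩,
          ⟨(y.1.1 / (Int.gcd (Int.gcd y.1.1 y.1.2.1) y.1.2.2 : ℕ),
              y.1.2.1 / (Int.gcd (Int.gcd y.1.1 y.1.2.1) y.1.2.2 : ℕ),
              y.1.2.2 / (Int.gcd (Int.gcd y.1.1 y.1.2.1) y.1.2.2 : ℕ)), (div_gcd_spec hn y.2).2⟩⟩
      invFun := fun x =>
        ⟨((x.1.1 : ℤ) * x.2.1.1, (x.1.1 : ℤ) * x.2.1.2.1, (x.1.1 : ℤ) * x.2.1.2.2), by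
          obtain ⟨⟨d, hd⟩, ⟨⟨a, b, c⟩, h, -⟩⟩ := x
          obtain ⟨-, hdvd⟩ := Finset.mem_filter.1 hd
          dsimp only at h ⊢
          have e1 : (((d : ℤ) * a) ^ 2 + ((d : ℤ) * b) ^ 2 + ((d : ℤ) * c) ^ 2) =
              ((d ^ 2 : ℕ) : ℤ) * (a ^ 2 + b ^ 2 + c ^ 2) := by push_cast; ring
          rw [e1, h, ← Nat.cast_mul, Nat.mul_div_cancel' hdvd]⟩
      left_inv := by
        rintro ⟨⟨a, b, c⟩, h⟩
        obtain ⟨ha, hb, hc⟩ := gcd_dvd a b c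
        apply Subtype.ext
        dsimp only
        rw [Int.mul_ediv_cancel' ha, Int.mul_ediv_cancel' hb, Int.mul_ediv_cancel' hc]
      right_inv := by
        rintro ⟨⟨d, hd⟩, ⟨⟨a, b, c⟩, h, hprim⟩⟩
        have hd1 : 1 ≤ d := (Finset.mem_Icc.1 (Finset.mem_filter.1 hd).1).1
        have hd0 : (d : ℤ) ≠ 0 := by exact_mod_cast (show d ≠ 0 by omega)
        have hgd : Int.gcd (Int.gcd ((d : ℤ) * a) ((d : ℤ) * b)) ((d : ℤ) * c) = d := by
          rw [gcd_mul, hprim, mul_one]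
        refine Sigma.ext (Subtype.ext hgd) ?_
        refine (Subtype.heq_iff_coe_eq fun x => by dsimp only; rw [hgd]).2 ?_
        dsimp only
        rw [hgd, Int.mul_ediv_cancel_left _ hd0, Int.mul_ediv_cancel_left _ hd0, Int.mul_ediv_cancel_left _ hd0] }
  rw [Nat.card_congr e, Nat.card_sigma, Finset.sum_coe_sort ((Finset.Icc 1 n).filter (fun d : ℕ => d ^ 2 ∣ n)) (fun d => Nat.card {y : ℤ × ℤ × ℤ // y.1 ^ 2 + y.2.1 ^ 2 + y.2.2 ^ 2 = ((n / d ^ 2 : ℕ) : ℤ) ∧ Int.gcd (Int.gcd y.1 y.2.1) y.2.2 = 1})]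

end Decomposition

/-! ## §2 `R₃(n) = 0` for `4 ∣ n` and for `n ≡ 7 (mod 8)` -/

section Vanishing

/-- **`R₃(n) = 0` when `4 ∣ n`**: `Σ yᵢ² ≡ 0 (mod 4)` forces all `yᵢ` even (the tree's
`even_of_four_dvd_sq_add_sq_add_sq`), so `2 ∣ gcd`; in particular `R₃(0) = 0`. [cite: Grosswald1985, Ch. 4 §8 (4.10) (G_n = 0 for n ≡ 0, 4 (mod 8))] -/
theorem card_primitive_eq_zero_of_four_dvd {n : ℕ} (h4 : 4 ∣ n) : Nat.card {y : ℤ × ℤ × ℤ // y.1 ^ 2 + y.2.1 ^ 2 + y.2.2 ^ 2 = (n : ℤ) ∧ Int.gcd (Int.gcd y.1 y.2.1) y.2.2 = 1} = 0 := by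
  rw [Nat.card_eq_zero]
  left
  refine ⟨fun y => ?_⟩
  obtain ⟨⟨a, b, c⟩, h, hprim⟩ := y
  dsimp only at h hprim
  have h' : a.natAbs ^ 2 + b.natAbs ^ 2 + c.natAbs ^ 2 = n := by
    apply Nat.cast_injective (R := ℤ)
    rw [Nat.cast_add, Nat.cast_add, Nat.cast_pow, Nat.cast_pow, Nat.cast_pow, Int.natAbs_sq, Int.natAbs_sq,
      Int.natAbs_sq]
    exact h
  obtain ⟨ha, hb, hc⟩ := even_of_four_dvd_sq_add_sq_add_sq (h' ▸ h4 : 4 ∣ a.natAbs ^ 2 + b.natAbs ^ 2 + c.natAbs ^ 2)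
  have h2 : 2 ∣ Int.gcd (Int.gcd a b) c :=
    Int.dvd_gcd (Int.natCast_dvd_natCast.2 (Int.dvd_gcd (Int.ofNat_dvd_left.2 ha) (Int.ofNat_dvd_left.2 hb)))
      (Int.ofNat_dvd_left.2 hc)
  rw [hprim] at h2
  exact absurd h2 (by norm_num)

/-- **`R₃(n) = 0` for `n ≡ 7 (mod 8)`** (no representation at all). [cite: Grosswald1985, Ch. 4 §8 (4.10)]
[cite: HardyWright2008, §20.10] -/
theorem card_primitive_eq_zero_of_mod_eight_eq_seven {n : ℕ} (h : n % 8 = 7) : Nat.card {y : ℤ × ℤ × ℤ // y.1 ^ 2 + y.2.1 ^ 2 + y.2.2 ^ 2 = (n : ℤ) ∧ Int.gcd (Int.gcd y.1 y.2.1) y.2.2 = 1} = 0 := by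
  rw [Nat.card_eq_zero]
  left
  refine ⟨fun y => ?_⟩
  obtain ⟨⟨a, b, c⟩, h', -⟩ := y
  refine not_sum_three_squares_of_mod_eight h a.natAbs b.natAbs c.natAbs ?_
  apply Nat.cast_injective (R := ℤ)
  rw [Nat.cast_add, Nat.cast_add, Nat.cast_pow, Nat.cast_pow, Nat.cast_pow, Int.natAbs_sq, Int.natAbs_sq,
    Int.natAbs_sq]
  exact h'

end Vanishing

/-! ## §3 The conductor sums of `H(n)`, `H(4n)` over `d² ∣ n` -/

section ConductorSums

/-- For `n ≡ 3 (mod 8)` and `d² ∣ n`: `d` is odd, `d² ≡ 1 (mod 8)`, so `n/d² ≡ 3 (mod 8)`. [folklore] -/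
private theorem div_sq_mod_eight {n d : ℕ} (h : n % 8 = 3) (hd : d ^ 2 ∣ n) : (n / d ^ 2) % 8 = 3 := by
  obtain ⟨e, he⟩ := hd
  have hd0 : d ≠ 0 := by rintro rfl; simp at he; omega
  rw [he, Nat.mul_div_cancel_left _ (by positivity)]
  rcases Nat.even_or_odd d with ⟨k, rfl⟩ | ⟨k, rfl⟩
  · have : n = 4 * (k ^ 2 * e) := by rw [he]; ring
    omega
  · obtain ⟨j, hj⟩ := Nat.even_mul_succ_self k
    have : n = 8 * (j * e) + e := by
      rw [he, show (2 * k + 1) ^ 2 = 4 * (k * (k + 1)) + 1 by ring, hj]; ring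
    omega

/-- For `n ≡ 1, 2 (mod 4)` and `d² ∣ n`: `n/d² ≡ n (mod 4)`. [folklore] -/
private theorem div_sq_mod_four {n d : ℕ} (h : n % 4 = 1 ∨ n % 4 = 2) (hd : d ^ 2 ∣ n) :
    (n / d ^ 2) % 4 = 1 ∨ (n / d ^ 2) % 4 = 2 := by
  obtain ⟨e, he⟩ := hd
  have hd0 : d ≠ 0 := by rintro rfl; simp at he; omega
  rw [he, Nat.mul_div_cancel_left _ (by positivity)]
  rcases Nat.even_or_odd d with ⟨k, rfl⟩ | ⟨k, rfl⟩
  · have : n = 4 * (k ^ 2 * e) := by rw [he]; ring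
    omega
  · obtain ⟨j, hj⟩ := Nat.even_mul_succ_self k
    have : n = 8 * (j * e) + e := by
      rw [he, show (2 * k + 1) ^ 2 = 4 * (k * (k + 1)) + 1 by ring, hj]; ring
    omega

/-- `(n : ℤ)/(d : ℤ)² = ↑(n / d²)`. [folklore] -/
private theorem cast_div_sq (n d : ℕ) : (n : ℤ) / ((d : ℤ)) ^ 2 = ((n / d ^ 2 : ℕ) : ℤ) := by
  rw [Int.natCast_div, Nat.cast_pow]

/-- **`H(n) = Σ_{d² ∣ n} h_w(−n/d²)` for `n ≡ 3 (mod 8)`**: every `d` with `d² ∣ n` is a conductor (`−n/d² ≡ 1 (mod 4)`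
automatically). [cite: Cohen1993, §5.3.2 Def. 5.3.6 and Lemma 5.3.7 (1), p. 234] [cite: Mortenson2017, Lemma 10] -/
theorem hurwitzClassNumber_eq_sum_sq_dvd {n : ℕ} (h : n % 8 = 3) :
    hurwitzClassNumber n = ∑ d ∈ ((Finset.Icc 1 n).filter (fun d : ℕ => d ^ 2 ∣ n)), weightedClassNumber (-((n / d ^ 2 : ℕ) : ℤ)) := by
  have hn : (0 : ℤ) < n := by exact_mod_cast (show 0 < n by omega)
  rw [hurwitzClassNumber_of_pos hn, Int.toNat_natCast]
  refine Finset.sum_congr (Finset.filter_congr fun d hd => ?_) fun d hd => ?_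
  · rw [← Nat.cast_pow, Int.natCast_dvd_natCast, Nat.cast_pow, cast_div_sq]
    constructor
    · rintro ⟨hdvd, -⟩; exact hdvd
    · intro hdvd
      have := div_sq_mod_eight h hdvd
      refine ⟨hdvd, Or.inr ?_⟩
      omega
  · rw [Finset.mem_filter] at hd
    rw [cast_div_sq]
    have hpos : 0 < n / d ^ 2 := Nat.div_pos (Nat.le_of_dvd (by omega) hd.2) (pow_pos (Finset.mem_Icc.1 hd.1).1 2)
    exact hurwitzWeight_mul_classNumber (by simp only [Left.neg_neg_iff]; exact_mod_cast hpos)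

/-- **`H(4n) = Σ_{d² ∣ n} h_w(−4n/d²)` for `n ≡ 1, 2 (mod 4)`**: the conductors `f` of `−4n` (`f² ∣ 4n`,
`−4n/f² ≡ 0, 1 (mod 4)`) are exactly the (odd) `d` with `d² ∣ n` — an even `f = 2g` would need `−n/g² ≡ 0, 1 (mod 4)`,
impossible for `n ≡ 1, 2 (mod 4)`. [cite: Cohen1993, §5.3.2 Def. 5.3.6 and Lemma 5.3.7 (1), p. 234]
[cite: Mortenson2017, §3 (proof of Thm. 4, n ≡ 1, 2 (mod 4))] -/
theorem hurwitzClassNumber_four_mul_eq_sum_sq_dvd {n : ℕ} (h : n % 4 = 1 ∨ n % 4 = 2) :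
    hurwitzClassNumber (4 * n) = ∑ d ∈ ((Finset.Icc 1 n).filter (fun d : ℕ => d ^ 2 ∣ n)), weightedClassNumber (-(4 * ((n / d ^ 2 : ℕ) : ℤ))) := by
  have hn0 : 0 < n := by omega
  have hN : (0 : ℤ) < ((4 * n : ℕ) : ℤ) := by exact_mod_cast (show 0 < 4 * n by omega)
  rw [show (4 : ℤ) * (n : ℤ) = ((4 * n : ℕ) : ℤ) by push_cast; ring, hurwitzClassNumber_of_pos hN, Int.toNat_natCast]
  -- the set of conductors of `−4n` is `{d : d² ∣ n}`
  have hset : (Finset.Icc 1 (4 * n)).filter (fun f : ℕ => ((f : ℤ)) ^ 2 ∣ ((4 * n : ℕ) : ℤ) ∧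
      ((-(((4 * n : ℕ) : ℤ) / ((f : ℤ)) ^ 2)) % 4 = 0 ∨ (-(((4 * n : ℕ) : ℤ) / ((f : ℤ)) ^ 2)) % 4 = 1)) = ((Finset.Icc 1 n).filter (fun d : ℕ => d ^ 2 ∣ n)) := by
    ext f
    rw [Finset.mem_filter, Finset.mem_filter, Finset.mem_Icc, Finset.mem_Icc, ← Nat.cast_pow,
      Int.natCast_dvd_natCast, Nat.cast_pow, cast_div_sq]
    constructor
    · rintro ⟨⟨hf1, -⟩, hdvd, hmod⟩
      rcases Nat.even_or_odd f with ⟨g, rfl⟩ | hodd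
      · -- `f = 2g`: `g² ∣ n` and `−n/g² ≡ 0, 1 (mod 4)` contradicts `n ≡ 1, 2 (mod 4)`
        exfalso
        have e4 : (g + g) ^ 2 = 4 * g ^ 2 := by ring
        rw [e4] at hdvd hmod
        have hg : g ^ 2 ∣ n := Nat.dvd_of_mul_dvd_mul_left (by norm_num) hdvd
        rw [Nat.mul_div_mul_left _ _ (by norm_num : 0 < 4)] at hmod
        have := div_sq_mod_four h hg
        omega
      · -- `f` odd: `f² ∣ n`
        have hcop : Nat.Coprime (f ^ 2) 4 := by
          rw [show (4 : ℕ) = 2 ^ 2 by norm_num]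
          exact (hodd.coprime_two_right).pow 2 2
        have hf : f ^ 2 ∣ n := hcop.dvd_of_dvd_mul_left hdvd
        refine ⟨⟨hf1, (Nat.le_self_pow two_ne_zero f).trans (Nat.le_of_dvd hn0 hf)⟩, hf⟩
    · rintro ⟨⟨hd1, hdn⟩, hdvd⟩
      refine ⟨⟨hd1, by omega⟩, Dvd.dvd.mul_left hdvd 4, Or.inl ?_⟩
      rw [Nat.mul_div_assoc 4 hdvd]
      push_cast
      omega
  rw [hset]
  refine Finset.sum_congr rfl fun d hd => ?_
  rw [Finset.mem_filter] at hd
  rw [cast_div_sq, Nat.mul_div_assoc 4 hd.2, Nat.cast_mul, Nat.cast_ofNat]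
  have hpos : 0 < n / d ^ 2 := Nat.div_pos (Nat.le_of_dvd hn0 hd.2) (pow_pos (Finset.mem_Icc.1 hd.1).1 2)
  exact hurwitzWeight_mul_classNumber (by linarith [(by exact_mod_cast hpos : (0 : ℤ) < (n / d ^ 2 : ℕ))])

end ConductorSums

/-! ## §4 `R₃(n) = 24·h_w(−n)` (`n ≡ 3 (mod 8)`), `R₃(n) = 12·h_w(−4n)` (`n ≡ 1, 2 (mod 4)`) -/

section Count

/-- `1 ∈ {d : d² ∣ n}` for `n ≥ 1`. [folklore] -/
private theorem one_mem {n : ℕ} (hn : 0 < n) : 1 ∈ ((Finset.Icc 1 n).filter (fun d : ℕ => d ^ 2 ∣ n)) := by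
  rw [Finset.mem_filter, Finset.mem_Icc]
  exact ⟨⟨le_rfl, hn⟩, by simp⟩

/-- For `d ≠ 1` with `d² ∣ n`, `n ≥ 1`: `n/d² < n`. [folklore] -/
private theorem div_sq_lt {n d : ℕ} (hn : 0 < n) (hd : d ∈ (((Finset.Icc 1 n).filter (fun d : ℕ => d ^ 2 ∣ n))).erase 1) : n / d ^ 2 < n := by
  obtain ⟨hd1, hd⟩ := Finset.mem_erase.1 hd
  have h1 : 1 ≤ d := (Finset.mem_Icc.1 (Finset.mem_filter.1 hd).1).1
  exact Nat.div_lt_self hn (by nlinarith [show 2 ≤ d by omega])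

/-- **GAUSS ∕ GROSSWALD THEOREM 2, the class `n ≡ 3 (mod 8)`: `R₃(n) = 24·h_w(−n)`** (`= 24 δ_n h(−n)`, `δ₃ = ⅓`):
strong induction on `n` — `24H(n) = r₃(n) = Σ_{d² ∣ n} R₃(n/d²)` against `H(n) = Σ_{d² ∣ n} h_w(−n/d²)`, the proper
divisors being settled by induction (`n/d² ≡ 3 (mod 8)` again). [cite: Grosswald1985, Ch. 4 §8 Thm. 2, (4.7)–(4.8)]
[cite: Mortenson2017, Thm. 3] [cite: Gauss1801, Art. 291] -/
theorem card_primitive_of_mod_eight_eq_three : ∀ {n : ℕ}, n % 8 = 3 →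
    (Nat.card {y : ℤ × ℤ × ℤ // y.1 ^ 2 + y.2.1 ^ 2 + y.2.2 ^ 2 = (n : ℤ) ∧ Int.gcd (Int.gcd y.1 y.2.1) y.2.2 = 1} : ℚ) = 24 * weightedClassNumber (-(n : ℤ)) := by
  intro n
  induction n using Nat.strong_induction_on with
  | _ n ih =>
    intro h
    have hn : 0 < n := by omega
    have hV := ThreeSquaresCount.card_eq_of_mod_eight_eq_three h
    rw [card_eq_sum_card_primitive hn, hurwitzClassNumber_eq_sum_sq_dvd h, Nat.cast_sum,
      ← Finset.add_sum_erase _ _ (one_mem hn), ← Finset.add_sum_erase _ _ (one_mem hn)] at hV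
    have hrest : ∑ d ∈ (((Finset.Icc 1 n).filter (fun d : ℕ => d ^ 2 ∣ n))).erase 1, (Nat.card {y : ℤ × ℤ × ℤ // y.1 ^ 2 + y.2.1 ^ 2 + y.2.2 ^ 2 = ((n / d ^ 2 : ℕ) : ℤ) ∧ Int.gcd (Int.gcd y.1 y.2.1) y.2.2 = 1} : ℚ) =
        ∑ d ∈ (((Finset.Icc 1 n).filter (fun d : ℕ => d ^ 2 ∣ n))).erase 1, 24 * weightedClassNumber (-((n / d ^ 2 : ℕ) : ℤ)) :=
      Finset.sum_congr rfl fun d hd =>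
        ih _ (div_sq_lt hn hd) (div_sq_mod_eight h (Finset.mem_filter.1 (Finset.mem_erase.1 hd).2).2)
    rw [hrest, ← Finset.mul_sum, Nat.one_pow, Nat.div_one] at hV
    linarith

/-- **GAUSS ∕ GROSSWALD THEOREM 2, the classes `n ≡ 1, 2 (mod 4)`: `R₃(n) = 12·h_w(−4n)`** (`= 12 δ_n h(−4n)`,
`δ₁ = ½`): the same induction with `12H(4n) = r₃(n)` and `H(4n) = Σ_{d² ∣ n} h_w(−4n/d²)`.
[cite: Grosswald1985, Ch. 4 §8 Thm. 2, (4.7)–(4.8)] [cite: Mortenson2017, Thm. 3] [cite: Gauss1801, Art. 291] -/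
theorem card_primitive_of_mod_four : ∀ {n : ℕ}, (n % 4 = 1 ∨ n % 4 = 2) →
    (Nat.card {y : ℤ × ℤ × ℤ // y.1 ^ 2 + y.2.1 ^ 2 + y.2.2 ^ 2 = (n : ℤ) ∧ Int.gcd (Int.gcd y.1 y.2.1) y.2.2 = 1} : ℚ) = 12 * weightedClassNumber (-(4 * (n : ℤ))) := by
  intro n
  induction n using Nat.strong_induction_on with
  | _ n ih =>
    intro h
    have hn : 0 < n := by omega
    have hV := ThreeSquaresCount.card_eq_of_mod_four h
    rw [card_eq_sum_card_primitive hn, hurwitzClassNumber_four_mul_eq_sum_sq_dvd h, Nat.cast_sum,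
      ← Finset.add_sum_erase _ _ (one_mem hn), ← Finset.add_sum_erase _ _ (one_mem hn)] at hV
    have hrest : ∑ d ∈ (((Finset.Icc 1 n).filter (fun d : ℕ => d ^ 2 ∣ n))).erase 1, (Nat.card {y : ℤ × ℤ × ℤ // y.1 ^ 2 + y.2.1 ^ 2 + y.2.2 ^ 2 = ((n / d ^ 2 : ℕ) : ℤ) ∧ Int.gcd (Int.gcd y.1 y.2.1) y.2.2 = 1} : ℚ) =
        ∑ d ∈ (((Finset.Icc 1 n).filter (fun d : ℕ => d ^ 2 ∣ n))).erase 1, 12 * weightedClassNumber (-(4 * ((n / d ^ 2 : ℕ) : ℤ))) :=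
      Finset.sum_congr rfl fun d hd =>
        ih _ (div_sq_lt hn hd) (div_sq_mod_four h (Finset.mem_filter.1 (Finset.mem_erase.1 hd).2).2)
    rw [hrest, ← Finset.mul_sum, Nat.one_pow, Nat.div_one] at hV
    linarith

/-- `h_w(Δ) = h(Δ)` (`BinaryQuadraticForm.classNumber`) for `Δ < −4`. [cite: Cohen1993, §5.3.2 Lemma 5.3.7, p. 234] -/
private theorem weightedClassNumber_eq_classNumber {Δ : ℤ} (hΔ : Δ < -4) :
    weightedClassNumber Δ = (classNumber Δ : ℚ) := by
  rw [← hurwitzWeight_mul_classNumber (by omega)]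
  unfold hurwitzWeight
  rw [if_neg (by omega), if_neg (by omega), one_mul]

/-- Grosswald's Theorem 2 with the plain class number, `n ≡ 3 (mod 8)`, `n > 3`: `R₃(n) = 24·h(−n)`.
[cite: Grosswald1985, Ch. 4 §8 Thm. 2] -/
theorem card_primitive_eq_classNumber_of_mod_eight_eq_three {n : ℕ} (h : n % 8 = 3) (hn : 3 < n) :
    (Nat.card {y : ℤ × ℤ × ℤ // y.1 ^ 2 + y.2.1 ^ 2 + y.2.2 ^ 2 = (n : ℤ) ∧ Int.gcd (Int.gcd y.1 y.2.1) y.2.2 = 1} : ℚ) = 24 * (classNumber (-(n : ℤ)) : ℚ) := by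
  rw [card_primitive_of_mod_eight_eq_three h, weightedClassNumber_eq_classNumber (by omega)]

/-- Grosswald's Theorem 2 with the plain class number, `n ≡ 1, 2 (mod 4)`, `n > 1`: `R₃(n) = 12·h(−4n)`
(e.g. «`R₃(5) = 12·2 = 24`»). [cite: Grosswald1985, Ch. 4 §8 Thm. 2 and the example n = 5] -/
theorem card_primitive_eq_classNumber_of_mod_four {n : ℕ} (h : n % 4 = 1 ∨ n % 4 = 2) (hn : 1 < n) :
    (Nat.card {y : ℤ × ℤ × ℤ // y.1 ^ 2 + y.2.1 ^ 2 + y.2.2 ^ 2 = (n : ℤ) ∧ Int.gcd (Int.gcd y.1 y.2.1) y.2.2 = 1} : ℚ) = 12 * (classNumber (-(4 * (n : ℤ))) : ℚ) := by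
  rw [card_primitive_of_mod_four h, weightedClassNumber_eq_classNumber (by omega)]

/-- `R₃(1) = 6 = 12·½` («`R₃(1) = 12·1·½ = 6`»; `h_w(−4) = ½`). [cite: Grosswald1985, Ch. 4 §8 (example n = 1)] -/
theorem card_primitive_one : Nat.card {y : ℤ × ℤ × ℤ // y.1 ^ 2 + y.2.1 ^ 2 + y.2.2 ^ 2 = ((1 : ℕ) : ℤ) ∧ Int.gcd (Int.gcd y.1 y.2.1) y.2.2 = 1} = 6 := by
  have h := card_primitive_of_mod_four (n := 1) (Or.inl rfl)
  have hw : weightedClassNumber (-(4 * ((1 : ℕ) : ℤ))) = 1 / 2 := by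
    unfold weightedClassNumber
    rw [if_neg (by norm_num), if_pos (by norm_num)]
  rw [hw, show (12 : ℚ) * (1 / 2) = 6 by norm_num] at h
  exact_mod_cast h

/-- `R₃(3) = 8 = 24·⅓` (`h_w(−3) = ⅓`; «we already know that `R₃(3) = 8`»). [cite: Grosswald1985, Ch. 4 §8 (examples)] -/
theorem card_primitive_three : Nat.card {y : ℤ × ℤ × ℤ // y.1 ^ 2 + y.2.1 ^ 2 + y.2.2 ^ 2 = ((3 : ℕ) : ℤ) ∧ Int.gcd (Int.gcd y.1 y.2.1) y.2.2 = 1} = 8 := by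
  have h := card_primitive_of_mod_eight_eq_three (n := 3) rfl
  have hw : weightedClassNumber (-((3 : ℕ) : ℤ)) = 1 / 3 := by
    unfold weightedClassNumber
    rw [if_pos (by norm_num)]
  rw [hw, show (24 : ℚ) * (1 / 3) = 8 by norm_num] at h
  exact_mod_cast h

end Count

/-! ## §5 Primitive representations exist iff `n ≢ 0, 4, 7 (mod 8)` -/

section Existence

/-- **`R₃(n) > 0 ⟺ 4 ∤ n` and `n ≢ 7 (mod 8)`** (i.e. `n ≢ 0, 4, 7 (mod 8)`): Gauss's count is `12·h_w(−4n) > 0`,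
`24·h_w(−n) > 0` in the classes `n ≡ 1, 2, 5, 6` resp. `3 (mod 8)` (class numbers are positive, the tree's
`weightedClassNumber_pos`), and `R₃(n) = 0` for `n ≡ 0, 4, 7 (mod 8)` (§2; Grosswald's `G_n = 0`).
[cite: Grosswald1985, Ch. 4 §8 Thm. 2 and (4.10)] [cite: Gauss1801, Art. 291] -/
theorem card_primitive_pos_iff (n : ℕ) : 0 < Nat.card {y : ℤ × ℤ × ℤ // y.1 ^ 2 + y.2.1 ^ 2 + y.2.2 ^ 2 = (n : ℤ) ∧ Int.gcd (Int.gcd y.1 y.2.1) y.2.2 = 1} ↔ (¬ 4 ∣ n ∧ n % 8 ≠ 7) := by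
  constructor
  · intro hpos
    refine ⟨fun h4 => ?_, fun h7 => ?_⟩
    · rw [card_primitive_eq_zero_of_four_dvd h4] at hpos
      exact lt_irrefl 0 hpos
    · rw [card_primitive_eq_zero_of_mod_eight_eq_seven h7] at hpos
      exact lt_irrefl 0 hpos
  · rintro ⟨h4, h7⟩
    have key : (0 : ℚ) < Nat.card {y : ℤ × ℤ × ℤ // y.1 ^ 2 + y.2.1 ^ 2 + y.2.2 ^ 2 = (n : ℤ) ∧ Int.gcd (Int.gcd y.1 y.2.1) y.2.2 = 1} := by
      rcases (show (n % 4 = 1 ∨ n % 4 = 2) ∨ n % 8 = 3 by omega) with h12 | h3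
      · rw [card_primitive_of_mod_four h12]
        exact mul_pos (by norm_num) (weightedClassNumber_pos (by omega) (by omega))
      · rw [card_primitive_of_mod_eight_eq_three h3]
        exact mul_pos (by norm_num) (weightedClassNumber_pos (by omega) (by omega))
    exact_mod_cast key

end Existence

end Literature.NumberTheory.Waring.ThreeSquaresPrimitiveCount
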